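import Summits.Schanuel.Schanuel.Theorems.ZilberEacAnalyticGerms
import Mathlib.Analysis.Calculus.Deriv.Mul
import Mathlib.Analysis.Calculus.Deriv.Add
import Mathlib.Analysis.Calculus.FDeriv.Analytic
import HarnessLib

/-!
# The equimodular class, XXXII: the derivation `d/dz` on the domain of analytic germs

HONEST FRAMING.  Cell `pub-schanuel` (Zilber's Exponential-Algebraic Closedness, case ladder;
host summit Schanuel), seat 2, gen 24.  Infrastructure for the reciprocal-type fibres (files
XXXIII–XXXV): the derivative of a germ, **`AGerm.D`** (`D (germ f) = germ f'`, well defined because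
functions that agree near `z₀` have equal derivatives near `z₀`), with the sum and Leibniz rules,
`D (zGerm) = 1`, `D` of scalars `= 0`, every germ is the germ of some analytic function
(`AGerm.exists_eq_mk`), and the differentiation rule for polynomial expressions
**`AGerm.D_eval`**: `D (P̂(v)) = P̂^D(v) + P̂'(v)·D v` for `P̂ ∈ (AGerm z₀)[t]`, where `P̂^D` has the
differentiated coefficients (`coeffD P̂`).  [folklore]; nothing here is specific to Schanuel's
conjecture (neither used nor implied).
-/

noncomputable section

open Filter Topology Polynomial

set_option linter.dupNamespace false

namespace Summit.Schanuel.Schanuel.Theorems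

namespace AGerm

variable {z₀ : ℂ}

/-- Every germ is the germ of a function analytic at `z₀`. [folklore] -/
theorem exists_eq_mk (v : AGerm z₀) : ∃ (f : ℂ → ℂ) (hf : AnalyticAt ℂ f z₀), v = mk z₀ hf := by
  induction v using Quotient.inductionOn' with
  | h f => exact ⟨f.1, f.2, rfl⟩

/-- Functions that agree near `z₀` have derivatives that agree near `z₀`. [folklore] -/
theorem deriv_eventuallyEq {f g : ℂ → ℂ} (h : f =ᶠ[𝓝 z₀] g) : deriv f =ᶠ[𝓝 z₀] deriv g := by
  filter_upwards [eventually_eventually_nhds.2 h] with z hz using Filter.EventuallyEq.deriv_eq hz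

/-- **The derivative of a germ**: `D (germ f) = germ f'`. [folklore] -/
def D (v : AGerm z₀) : AGerm z₀ :=
  Quotient.liftOn' v (fun f => mk z₀ ((f.2 : AnalyticAt ℂ f.1 z₀).deriv)) fun f g hfg => by
    have h : f - g ∈ nullIdeal z₀ := (Submodule.quotientRel_def _).1 hfg
    rw [mem_nullIdeal] at h
    have hfg' : (f.1 : ℂ → ℂ) =ᶠ[𝓝 z₀] g.1 := by
      filter_upwards [h] with z hz
      exact sub_eq_zero.1 hz
    exact (mk_eq_mk_iff _ _).2 (deriv_eventuallyEq hfg')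

/-- `D (germ f) = germ (deriv f)`. [folklore] -/
theorem D_mk {f : ℂ → ℂ} (hf : AnalyticAt ℂ f z₀) : D (mk z₀ hf) = mk z₀ hf.deriv := rfl

/-- `D` is additive. [folklore] -/
theorem D_add (v w : AGerm z₀) : D (v + w) = D v + D w := by
  obtain ⟨f, hf, rfl⟩ := exists_eq_mk v
  obtain ⟨g, hg, rfl⟩ := exists_eq_mk w
  rw [← mk_add, D_mk, D_mk, D_mk, ← mk_add]
  refine (mk_eq_mk_iff _ _).2 ?_
  filter_upwards [hf.eventually_analyticAt, hg.eventually_analyticAt] with z hfz hgz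
  exact deriv_add hfz.differentiableAt hgz.differentiableAt

/-- **Leibniz rule** for `D`. [folklore] -/
theorem D_mul (v w : AGerm z₀) : D (v * w) = v * D w + w * D v := by
  obtain ⟨f, hf, rfl⟩ := exists_eq_mk v
  obtain ⟨g, hg, rfl⟩ := exists_eq_mk w
  rw [← mk_mul, D_mk, D_mk, D_mk, ← mk_mul, ← mk_mul, ← mk_add]
  refine (mk_eq_mk_iff _ _).2 ?_
  filter_upwards [hf.eventually_analyticAt, hg.eventually_analyticAt] with z hfz hgz
  rw [deriv_mul hfz.differentiableAt hgz.differentiableAt]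
  simp only [Pi.add_apply, Pi.mul_apply]
  ring

/-- `D` kills scalars. [folklore] -/
theorem D_algebraMap (c : ℂ) : D (algebraMap ℂ (AGerm z₀) c) = 0 := by
  rw [← mk_const, D_mk]
  have h0 : AnalyticAt ℂ (fun _ : ℂ => (0 : ℂ)) z₀ := analyticAt_const
  have : mk z₀ ((analyticAt_const : AnalyticAt ℂ (fun _ : ℂ => c) z₀).deriv) = mk z₀ h0 :=
    mk_congr _ _ fun z => by simp
  rw [this]
  exact (mk_const (z₀ := z₀) (0 : ℂ)).trans (map_zero _)

/-- `D 0 = 0`. [folklore] -/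
theorem D_zero : D (0 : AGerm z₀) = 0 := by
  have h := D_algebraMap (z₀ := z₀) 0
  rwa [map_zero] at h

/-- `D 1 = 0`. [folklore] -/
theorem D_one : D (1 : AGerm z₀) = 0 := by
  have h := D_algebraMap (z₀ := z₀) 1
  rwa [map_one] at h

/-- `D` is `ℂ`-linear. [folklore] -/
theorem D_smul (c : ℂ) (v : AGerm z₀) : D (c • v) = c • D v := by
  rw [Algebra.smul_def, D_mul, D_algebraMap, mul_zero, add_zero, Algebra.smul_def]

/-- `D` of scalar multiples by germs: `D (a * v) = a * D v + v * D a`. [folklore] -/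
theorem D_neg (v : AGerm z₀) : D (-v) = -D v := by
  rw [← neg_one_smul ℂ v, D_smul, neg_one_smul]

/-- `D` is subtractive. [folklore] -/
theorem D_sub (v w : AGerm z₀) : D (v - w) = D v - D w := by
  rw [sub_eq_add_neg, D_add, D_neg, sub_eq_add_neg]

/-- `D` of powers. [folklore] -/
theorem D_pow (v : AGerm z₀) (n : ℕ) : D (v ^ n) = (n : AGerm z₀) * v ^ (n - 1) * D v := by
  induction n with
  | zero => rw [pow_zero, D_one, Nat.cast_zero, zero_mul, zero_mul]
  | succ n ih =>
    rw [pow_succ, D_mul, ih, Nat.add_sub_cancel]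
    rcases Nat.eq_zero_or_pos n with h | h
    · subst h; simp
    · obtain ⟨k, rfl⟩ : ∃ k, n = k + 1 := ⟨n - 1, (Nat.sub_add_cancel h).symm⟩
      simp only [Nat.add_sub_cancel, Nat.cast_add, Nat.cast_one, pow_succ]
      ring

/-- `D` of a finite sum. [folklore] -/
theorem D_sum {ι : Type*} (s : Finset ι) (v : ι → AGerm z₀) :
    D (∑ i ∈ s, v i) = ∑ i ∈ s, D (v i) := by
  classical
  induction s using Finset.induction_on with
  | empty => rw [Finset.sum_empty, Finset.sum_empty, D_zero]
  | insert a s ha ih => rw [Finset.sum_insert ha, Finset.sum_insert ha, D_add, ih]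

/-- `D (zGerm) = 1`. [folklore] -/
theorem D_zGerm : D (zGerm z₀) = 1 := by
  rw [zGerm, D_mk, ← mk_one]
  exact mk_congr _ _ fun z => by simp

/-- **A germ with `D v = 0`... (not needed).**  Instead: `D` of a polynomial in `zGerm` is the
derivative polynomial. [folklore] -/
theorem D_aeval_zGerm (r : ℂ[X]) :
    D (Polynomial.aeval (zGerm z₀) r) = Polynomial.aeval (zGerm z₀) (derivative r) := by
  rw [aeval_zGerm, aeval_zGerm, D_mk]
  exact mk_congr _ _ fun z => by simp [Polynomial.deriv]

end AGerm

/-! ## Differentiating polynomial expressions with germ coefficients -/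

/-- `coeffD P̂ = Σ_j (D p̂_j) t^j`: the coefficientwise derivative of `P̂ ∈ (AGerm z₀)[t]`. [folklore] -/
def coeffD {z₀ : ℂ} (P : Polynomial (AGerm z₀)) : Polynomial (AGerm z₀) :=
  ∑ j ∈ Finset.range (P.natDegree + 1), Polynomial.monomial j (AGerm.D (P.coeff j))

/-- Coefficients of `coeffD`. [folklore] -/
theorem coeff_coeffD {z₀ : ℂ} (P : Polynomial (AGerm z₀)) (j : ℕ) :
    (coeffD P).coeff j = AGerm.D (P.coeff j) := by
  rw [coeffD, Polynomial.finsetSum_coeff]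
  simp only [Polynomial.coeff_monomial, Finset.sum_ite_eq', Finset.mem_range]
  split_ifs with h
  · rfl
  · rw [Polynomial.coeff_eq_zero_of_natDegree_lt (by omega), AGerm.D_zero]

/-- **Differentiation of `P̂(v)`**: `D (P̂.eval v) = (coeffD P̂).eval v + P̂'.eval v · D v`.
[folklore] -/
theorem AGerm.D_eval {z₀ : ℂ} (P : Polynomial (AGerm z₀)) (v : AGerm z₀) :
    AGerm.D (P.eval v) = (coeffD P).eval v + (derivative P).eval v * AGerm.D v := by
  set n := P.natDegree with hn'
  have hn : P.natDegree < n + 1 := Nat.lt_succ_self _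
  have hcD : (coeffD P).natDegree < n + 1 := by
    refine Nat.lt_succ_of_le ?_
    rw [coeffD]
    refine Polynomial.natDegree_sum_le_of_forall_le _ _ fun j hj => ?_
    exact (Polynomial.natDegree_monomial_le _).trans (Nat.lt_succ_iff.1 (Finset.mem_range.1 hj))
  have hder : (derivative P).natDegree < n + 1 :=
    Nat.lt_succ_of_le ((Polynomial.natDegree_derivative_le P).trans (Nat.sub_le _ _))
  have h1 : AGerm.D (P.eval v) = ∑ j ∈ Finset.range (n + 1), v ^ j * AGerm.D (P.coeff j) +
      (∑ j ∈ Finset.range (n + 1), P.coeff j * ((j : AGerm z₀) * v ^ (j - 1))) * AGerm.D v := by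
    rw [Polynomial.eval_eq_sum_range' hn, AGerm.D_sum, Finset.sum_mul, ← Finset.sum_add_distrib]
    refine Finset.sum_congr rfl fun j _ => ?_
    rw [AGerm.D_mul, AGerm.D_pow]
    ring
  have h2 : (coeffD P).eval v = ∑ j ∈ Finset.range (n + 1), v ^ j * AGerm.D (P.coeff j) := by
    rw [Polynomial.eval_eq_sum_range' hcD]
    refine Finset.sum_congr rfl fun j _ => ?_
    rw [coeff_coeffD, mul_comm]
  have hcoeff : P.coeff (n + 1) = 0 := Polynomial.coeff_eq_zero_of_natDegree_lt (by omega)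
  have h3 : (derivative P).eval v =
      ∑ j ∈ Finset.range (n + 1), P.coeff j * ((j : AGerm z₀) * v ^ (j - 1)) := by
    rw [Polynomial.eval_eq_sum_range' hder, Finset.sum_range_succ, Polynomial.coeff_derivative, hcoeff,
      zero_mul, zero_mul, add_zero, Finset.sum_range_succ']
    simp only [Polynomial.coeff_derivative, Nat.cast_zero, zero_mul, mul_zero, add_zero,
      Nat.add_sub_cancel, Nat.cast_add, Nat.cast_one]
    refine Finset.sum_congr rfl fun j _ => ?_
    ring
  rw [h1, h2, h3]

end Summit.Schanuel.Schanuel.Theorems
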